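import Mathlib
import HarnessLib
import Summits.HubbardSuperconductivity.HubbardSuperconductivity.Theorems.KLProgrammeKLRegimeCountertermShapeJD
import Summits.HubbardSuperconductivity.HubbardSuperconductivity.Theorems.KLProgrammeKLRegimeSplitBundleV16

/-!
# Route `KLProgramme` — crux K3, GEN 6 (bundle `klPredsV16`: (R-deg) degree-capped frames `FrameOKDeg`, (E3c) `FrameLipschitzFnTD` capping the
# comparison frame, (MS-Q) `TwoLegSizesMSTQ`, (E3f-AT) `TwoLegVolumeRateAT`, engine slot `EngineBoundsAtV10S`): the COUNTERTERM child's BODY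
# `CountertermP2 klPredsV16 klWindowC` — seat hubbard-kl-k3c3-p2, technique «fixed point on FrameOK's tube (contraction in the frame norm)»

One instance of the bundle-generic body `CtJ.countertermP2_of_shapeJD_degCapQ` (`…CountertermShapeJD`, p506725; chain `…ContinuationJD` p504737 /
`…OneVolumeJD` p506074): the frame slot `FrameOKDeg = FrameOK ∧ K.degree ≤ 2^21·16^N` by `Iff.rfl`; `renorm = RenormalisedAtF` by `id`; history
`histV15 = split ∧ renorm ∧ engine`; from `TwoLegStepV16`: the `C⁴` + tier-1 sizes (`TwoLegCoreTD.sizesT1`), the capped (E3c) clause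
(`TwoLegCoreTD.lipschitz` — comparison frames in `FrameOKDeg (ctRenMs G) U (nScales β) μ` = the slot, definitionally), the (MS-Q) conjunct
(`TwoLegSizesMSTQ`, unfolding to the `Q.CE`-keyed decomposition the provider `selfMapProviderA_degCapNumeral_of_ceBudget` consumes), and the (E3f-AT)
rate through `twoLegVolumeRateAT_apply_of_V16` at child 2's cutoff threshold `Mq := fun L => max (Mh L) (Q.M0 β L)` (plan g14 (R18), HOME STATUS
2026-08-27T06:46:01Z; the transfer is SCALE-MAJOR, `ct_volumeTransfer_of_rateA`).  Result:

  **`CtJ.countertermP2_klPredsV16 : CountertermP2 klPredsV16 klWindowC`.**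

The gen-6 route closer is the one-liner `KLRegimeCounterterm.KLRegimeCountertermV16_of := KLRegimeSplit.CtJ.countertermP2_klPredsV16`, filed
`--workitem` on the gen-6 Counterterm item at birth.  Reads of `TwoLegStepV16` (audit column (iv)): `TwoLegCoreTD`'s `C⁴` conjunct and tier-1
`j ≤ 2` sizes, `FrameLipschitzFnTD histV15`, `TwoLegSizesMSTQ` (all of it), `TwoLegVolumeRateAT` (V16 antecedent at `Mq = max Mh M0`), and the
structural `RenormalisedAtF n → histV15 K n`; nothing else.  Proof only; nothing is asserted about the Hubbard model beyond the hypothesis block.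
-/

noncomputable section

namespace Summit.HubbardSuperconductivity.HubbardSuperconductivity.Theorems.KLRegimeSplit

set_option linter.dupNamespace false -- summit = problem name (single-conjunct summit), D-0017

open Real Finset
open Literature.MathematicalPhysics.QuantumLattice Literature.Probability.LatticeModels
open Summit.HubbardSuperconductivity.HubbardSuperconductivity.Theorems.KLProgrammeLegKernels

namespace CtJ

/-- **THE COUNTERTERM CHILD OF K3 AT GEN 6**: `CountertermP2 klPredsV16 klWindowC` — one degree-capped `TrigPolyC4v` frame (`0` or a Jackson mean
of degree `d + d ≤ 2^21·16^{nScales β}`), chosen before the volume, renormalised at every scale at every large volume; by the Jackson-smoothed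
wholesale continuation on the function pieces (self-map of the capped tube with the `Q.CE`-keyed multi-slot room, contraction through the capped
(E3c), exact reading, scale-major volume transfer by (E3f-AT)). -/
theorem countertermP2_klPredsV16 : CountertermP2 klPredsV16 klWindowC :=
  countertermP2_of_shapeJD_degCapQ (Pr := klPredsV16)
    (fun L M _ _ G P Q R β U μ K j => histV15 L M G P Q R β U μ K j)
    (fun L M _ _ G Q R β U μ K n => TwoLegSizesMSFnQ L M G Q R β U μ K.eval n)
    (fun _ _ _ _ _ => Iff.rfl) (fun _ _ _ _ _ _ _ _ _ _ h => h) (fun _ _ _ _ _ _ _ _ _ _ _ _ _ hs hr he => ⟨hs, hr, he⟩)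
    (fun _ _ _ _ _ _ _ _ _ _ _ h => h)
    (fun _ _ _ _ _ _ _ _ _ _ _ _ h => ⟨h.1.sizesT1, fun K' hK' hh q => h.1.lipschitz K' hK' hh q, h.2.1⟩)
    (fun _ _ _ _ _ _ _ _ _ _ _ _ _ Mq h hM hMq hall _ _ _ _ hL hM' hMq' θ =>
      twoLegVolumeRateAT_apply_of_V16 h Mq hM hMq hall hL hM' hMq' θ)

end CtJ

end Summit.HubbardSuperconductivity.HubbardSuperconductivity.Theorems.KLRegimeSplit

end
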